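import Summits.KontsevichZagierPeriods.KontsevichZagierPeriods.Theorems.FermatIsogenyBetaProductSectorStubTwinDupStepCharts

/-!
# `BetaProductSector` (stmt-KontsevichZagierPeriods-3898), line `registered` (v3) — stub `stub_twinDupStep`,
# part 2: the left chart of the twin-duplication move X9

Second part of the twin-duplication move X9 `B(a+b-½, b+½)·B(b, a+½-b) = 4^{a-b}·B(a+b-½, a+½-b)·B(a, 2b)`
(see part 1, `…StubTwinDupStepCharts`). On the parameter triangle `Ω = {(t,m) | 0 < t < m < 1}` put
`D̂ = m(m-t)² + t(1+m)²`. This file supplies, in the format of `KZ.exists_dirichletPolarChart`, the rational chart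

* `TwinDupStep.exists_chartLambda`: `λ(t,m) = (t(1+m)²/D̂, ((1-m)/(1+m))²)` carries `Ω` injectively ONTO the open
  box `(0,1)²` (`|det| = 4m(1-m)(m²-t²)/((1+m)D̂²)`; the first coordinate is strictly increasing in `t`,
  `t₁D̂(t₂) - t₂D̂(t₁) = m(t₁-t₂)(m²-t₁t₂)`, onto by the intermediate value theorem; the second is a Möbius
  involution of `(0,1)` squared),

by which the LEFT box `[(0,1)², x^{a+b-3/2}(1-x)^{b-½}y^{b-1}(1-y)^{a-b-½}]` of the move is a rational image of `Ω`
(the point `(t,m)` is `(n², ns)` for the smaller negative root `-n` and a positive root `s` of the quartic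
`s⁴ - αs² + βs + 1` attached to the Mellin point). Everything is proved; no `def`, no named fact.
-/

noncomputable section

open MeasureTheory Set
open Literature.ModelTheory.ExponentialFields (IsSemialgebraic)

namespace Summit.KontsevichZagierPeriods.FermatIsogeny.BetaProductSectorStubs

open Literature.NumberTheory.Transcendental
open Literature.NumberTheory.Transcendental.KZ

namespace TwinDupStep

/-- The difference quotient of the first coordinate of `λ`:
`t₁D̂(t₂,m) - t₂D̂(t₁,m) = m(t₁-t₂)(m²-t₁t₂)`. [folklore] -/
theorem lambda_diff (m t₁ t₂ : ℝ) :
    t₁ * (m * (m - t₂) ^ 2 + t₂ * (1 + m) ^ 2) - t₂ * (m * (m - t₁) ^ 2 + t₁ * (1 + m) ^ 2) =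
      m * (t₁ - t₂) * (m ^ 2 - t₁ * t₂) := by
  ring

/-- The Möbius involution `m ↦ (1-m)/(1+m)` of `(0,1)`, at `m = (1-r)/(1+r)`, returns `r`. [folklore] -/
theorem moebius_moebius {r : ℝ} (hr : 0 ≤ r) :
    (1 - (1 - r) / (1 + r)) / (1 + (1 - r) / (1 + r)) = r := by
  have h1 : (1 + r) ≠ 0 := by positivity
  field_simp
  ring

/-- **The chart `λ(t,m) = (t(1+m)²/D̂, ((1-m)/(1+m))²)`**, `D̂ = m(m-t)² + t(1+m)²`, of the open box `(0,1)²` by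
the parameter triangle `Ω = {0 < t < m < 1}` of the twin-duplication move: a `ℚ`-rational map, differentiable
on `Ω` with `|det Dλ| = 4m(1-m)(m²-t²)/((1+m)D̂²)`, injective on `Ω` and ONTO the box. [folklore] -/
theorem exists_chartLambda : ∃ (Φ : (Fin 2 → ℝ) → (Fin 2 → ℝ)) (Φ' : (Fin 2 → ℝ) → (Fin 2 → ℝ) →L[ℝ] (Fin 2 → ℝ)), (∀ z, Φ z 0 = z 0 * (1 + z 1) ^ 2 / (z 1 * (z 1 - z 0) ^ 2 + z 0 * (1 + z 1) ^ 2)) ∧ (∀ z, Φ z 1 = ((1 - z 1) / (1 + z 1)) ^ 2) ∧ Literature.NumberTheory.Transcendental.IsSemialgebraicMapOn ℚ {z : Fin 2 → ℝ | 0 < z 0 ∧ z 0 < z 1 ∧ z 1 < 1} Φ ∧ (∀ z ∈ {z : Fin 2 → ℝ | 0 < z 0 ∧ z 0 < z 1 ∧ z 1 < 1}, HasFDerivAt Φ (Φ' z) z) ∧ Set.InjOn Φ {z : Fin 2 → ℝ | 0 < z 0 ∧ z 0 < z 1 ∧ z 1 < 1} ∧ Φ '' {z : Fin 2 → ℝ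 | 0 < z 0 ∧ z 0 < z 1 ∧ z 1 < 1} = {z : Fin 2 → ℝ | z 0 ∈ Set.Ioo (0:ℝ) 1 ∧ z 1 ∈ Set.Ioo (0:ℝ) 1} ∧ (∀ z ∈ {z : Fin 2 → ℝ | 0 < z 0 ∧ z 0 < z 1 ∧ z 1 < 1}, |(Φ' z).det| = 4 * z 1 * (1 - z 1) * (z 1 ^ 2 - z 0 ^ 2) / ((1 + z 1) * (z 1 * (z 1 - z 0) ^ 2 + z 0 * (1 + z 1) ^ 2) ^ 2)) := by
  set Φ : (Fin 2 → ℝ) → (Fin 2 → ℝ) :=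
    fun z => ![z 0 * (1 + z 1) ^ 2 / (z 1 * (z 1 - z 0) ^ 2 + z 0 * (1 + z 1) ^ 2), ((1 - z 1) / (1 + z 1)) ^ 2]
    with hΦ
  -- numerators, denominators and their coefficient-form partial derivatives
  set N : (Fin 2 → ℝ) → ℝ := fun z => z 0 * (1 + z 1) ^ 2 with hN
  set D : (Fin 2 → ℝ) → ℝ := fun z => z 1 * (z 1 - z 0) ^ 2 + z 0 * (1 + z 1) ^ 2 with hD
  set n₀ : (Fin 2 → ℝ) → ℝ := fun z => (1 + z 1) ^ 2 with hn₀
  set n₁ : (Fin 2 → ℝ) → ℝ := fun z => 2 * z 0 * (1 + z 1) with hn₁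
  set d₀ : (Fin 2 → ℝ) → ℝ := fun z => -(2 * z 1 * (z 1 - z 0)) + (1 + z 1) ^ 2 with hd₀
  set d₁ : (Fin 2 → ℝ) → ℝ := fun z => (z 1 - z 0) ^ 2 + 2 * z 1 * (z 1 - z 0) + 2 * z 0 * (1 + z 1) with hd₁
  set N₂ : (Fin 2 → ℝ) → ℝ := fun z => (1 - z 1) ^ 2 with hN₂
  set D₂ : (Fin 2 → ℝ) → ℝ := fun z => (1 + z 1) ^ 2 with hD₂
  set Φ' : (Fin 2 → ℝ) → (Fin 2 → ℝ) →L[ℝ] (Fin 2 → ℝ) := fun z => LinearMap.toContinuousLinearMap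
    (Matrix.toLin' !![(n₀ z * D z - N z * d₀ z) / D z ^ 2, (n₁ z * D z - N z * d₁ z) / D z ^ 2;
      (0 * D₂ z - N₂ z * 0) / D₂ z ^ 2, (-(2 * (1 - z 1)) * D₂ z - N₂ z * (2 * (1 + z 1))) / D₂ z ^ 2])
    with hΦ'
  have hΦ0 : ∀ z, Φ z 0 = z 0 * (1 + z 1) ^ 2 / (z 1 * (z 1 - z 0) ^ 2 + z 0 * (1 + z 1) ^ 2) := fun z => rfl
  have hΦ1 : ∀ z, Φ z 1 = ((1 - z 1) / (1 + z 1)) ^ 2 := fun z => rfl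
  have hderiv : ∀ z : Fin 2 → ℝ, D z ≠ 0 → D₂ z ≠ 0 → HasFDerivAt Φ (Φ' z) z := by
    intro z hz hz₂
    have h0 := hasFDerivAt_fst_coeff z
    have h1 := hasFDerivAt_snd_coeff z
    have hNd : HasFDerivAt N (n₀ z • ContinuousLinearMap.proj (R := ℝ) (φ := fun _ : Fin 2 => ℝ) 0 +
        n₁ z • ContinuousLinearMap.proj (R := ℝ) (φ := fun _ : Fin 2 => ℝ) 1) z := by
      have h := h0.mul ((h1.const_add 1).mul (h1.const_add 1))
      have hf : N = fun w => w 0 * ((1 + w 1) * (1 + w 1)) := funext fun w => by rw [hN]; ring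
      rw [hf]
      refine h.congr_fderiv (ContinuousLinearMap.ext fun v => ?_)
      simp [hn₀, hn₁]
      ring
    have hDd : HasFDerivAt D (d₀ z • ContinuousLinearMap.proj (R := ℝ) (φ := fun _ : Fin 2 => ℝ) 0 +
        d₁ z • ContinuousLinearMap.proj (R := ℝ) (φ := fun _ : Fin 2 => ℝ) 1) z := by
      have h := (h1.mul ((h1.sub h0).mul (h1.sub h0))).add (h0.mul ((h1.const_add 1).mul (h1.const_add 1)))
      have hf : D = fun w => w 1 * ((w 1 - w 0) * (w 1 - w 0)) + w 0 * ((1 + w 1) * (1 + w 1)) :=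
        funext fun w => by rw [hD]; ring
      rw [hf]
      refine h.congr_fderiv (ContinuousLinearMap.ext fun v => ?_)
      simp [hd₀, hd₁]
      ring
    have hN₂d : HasFDerivAt N₂ ((0:ℝ) • ContinuousLinearMap.proj (R := ℝ) (φ := fun _ : Fin 2 => ℝ) 0 +
        (-(2 * (1 - z 1))) • ContinuousLinearMap.proj (R := ℝ) (φ := fun _ : Fin 2 => ℝ) 1) z := by
      have h := (h1.const_sub 1).mul (h1.const_sub 1)
      have hf : N₂ = fun w => (1 - w 1) * (1 - w 1) := funext fun w => by rw [hN₂]; ring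
      rw [hf]
      refine h.congr_fderiv (ContinuousLinearMap.ext fun v => ?_)
      simp
      ring
    have hD₂d : HasFDerivAt D₂ ((0:ℝ) • ContinuousLinearMap.proj (R := ℝ) (φ := fun _ : Fin 2 => ℝ) 0 +
        (2 * (1 + z 1)) • ContinuousLinearMap.proj (R := ℝ) (φ := fun _ : Fin 2 => ℝ) 1) z := by
      have h := (h1.const_add 1).mul (h1.const_add 1)
      have hf : D₂ = fun w => (1 + w 1) * (1 + w 1) := funext fun w => by rw [hD₂]; ring
      rw [hf]
      refine h.congr_fderiv (ContinuousLinearMap.ext fun v => ?_)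
      simp
      ring
    have hsq : (fun w => ((1 - w 1) / (1 + w 1)) ^ 2) = fun w => N₂ w / D₂ w :=
      funext fun w => by rw [hN₂, hD₂, div_pow]
    have key := hasFDerivAt_chart2 (hasFDerivAt_div_coeff hNd hDd hz) (hsq ▸ hasFDerivAt_div_coeff hN₂d hD₂d hz₂)
    exact key
  have hdet : ∀ z : Fin 2 → ℝ, D z ≠ 0 → 1 + z 1 ≠ 0 → (Φ' z).det =
      -(4 * z 1 * (1 - z 1) * (z 1 ^ 2 - z 0 ^ 2) / ((1 + z 1) * D z ^ 2)) := by
    intro z hz h1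
    have hz₂ : D₂ z ≠ 0 := by rw [hD₂]; exact pow_ne_zero 2 h1
    rw [hΦ', det_chart2]
    rw [hD₂] at hz₂ ⊢
    field_simp
    rw [hD, hN, hn₀, hd₀, hN₂]
    ring
  have hDpos : ∀ z ∈ {z : Fin 2 → ℝ | 0 < z 0 ∧ z 0 < z 1 ∧ z 1 < 1}, 0 < D z :=
    fun z hz => denomL_pos hz.1.le (lt_trans hz.1 hz.2.1) hz.2.2.le
  refine ⟨Φ, Φ', hΦ0, hΦ1, ?_, fun z hz => hderiv z (hDpos z hz).ne'
    (by rw [hD₂]; exact pow_ne_zero 2 (by linarith [hz.1, hz.2.1] : (0:ℝ) < 1 + z 1).ne'), ?_, ?_,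
    fun z hz => ?_⟩
  · refine IsSemialgebraicMapOn.of_forall QuadStep.isSemialgebraic_wedge (Fin.forall_fin_two.2 ⟨?_, ?_⟩)
    · exact (isSemialgebraicFunOn_aeval_div_aeval QuadStep.isSemialgebraic_wedge
        (MvPolynomial.X 0 * (1 + MvPolynomial.X 1) ^ 2 : MvPolynomial (Fin 2) ℚ)
        (MvPolynomial.X 1 * (MvPolynomial.X 1 - MvPolynomial.X 0) ^ 2 +
          MvPolynomial.X 0 * (1 + MvPolynomial.X 1) ^ 2)
        (fun x hx => by simpa using (hDpos x hx).ne')).congr (fun z _ => by simp [hΦ0])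
    · exact (isSemialgebraicFunOn_aeval_div_aeval QuadStep.isSemialgebraic_wedge
        ((1 - MvPolynomial.X 1) ^ 2 : MvPolynomial (Fin 2) ℚ) ((1 + MvPolynomial.X 1) ^ 2)
        (fun x hx => by
          have : (0:ℝ) < 1 + x 1 := by linarith [hx.1, hx.2.1]
          simpa using (pow_pos this 2).ne')).congr (fun z _ => by simp [hΦ1, div_pow])
  · intro x hx y hy hxy
    have e0 := congrFun hxy 0
    have e1 := congrFun hxy 1
    simp only [hΦ0, hΦ1] at e0 e1
    have hx1 : 0 < x 1 := lt_trans hx.1 hx.2.1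
    have hy1 : 0 < y 1 := lt_trans hy.1 hy.2.1
    -- second coordinates: the Möbius involution squared is injective on `(0,1)`
    have hqx : 0 < (1 - x 1) / (1 + x 1) := div_pos (by linarith [hx.2.2]) (by linarith)
    have hqy : 0 < (1 - y 1) / (1 + y 1) := div_pos (by linarith [hy.2.2]) (by linarith)
    have e1' : (1 - x 1) / (1 + x 1) = (1 - y 1) / (1 + y 1) := (pow_left_inj₀ hqx.le hqy.le two_ne_zero).1 e1
    rw [div_eq_div_iff (by linarith : (1 + x 1) ≠ 0) (by linarith : (1 + y 1) ≠ 0)] at e1'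
    have h1 : x 1 = y 1 := by linarith
    -- first coordinates: strict monotonicity in `t`
    rw [h1] at e0
    have hpow : (1 + y 1) ^ 2 ≠ 0 := by positivity
    rw [div_eq_div_iff (denomL_pos hx.1.le hy1 hy.2.2.le).ne' (hDpos y hy).ne'] at e0
    have e0' : x 0 * (y 1 * (y 1 - y 0) ^ 2 + y 0 * (1 + y 1) ^ 2) =
        y 0 * (y 1 * (y 1 - x 0) ^ 2 + x 0 * (1 + y 1) ^ 2) :=
      mul_left_cancel₀ hpow (by linear_combination e0)
    have key := lambda_diff (y 1) (x 0) (y 0)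
    rw [e0', sub_self] at key
    have hm2 : 0 < y 1 ^ 2 - x 0 * y 0 := by
      have h2 : x 0 < y 1 := h1 ▸ hx.2.1
      nlinarith [hx.1, hy.1, hy.2.1]
    have h0 : x 0 = y 0 := by
      rcases mul_eq_zero.1 key.symm with h | h
      · rcases mul_eq_zero.1 h with h | h
        · linarith
        · linarith
      · linarith
    exact funext (Fin.forall_fin_two.2 ⟨h0, h1⟩)
  · ext w
    constructor
    · rintro ⟨z, hz, rfl⟩
      obtain ⟨h0, h01, h1⟩ := hz
      have hm : 0 < z 1 := lt_trans h0 h01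
      have hD' := hDpos z ⟨h0, h01, h1⟩
      simp only [mem_setOf_eq, hΦ0, hΦ1]
      refine ⟨⟨div_pos (by positivity) hD', ?_⟩, ?_⟩
      · rw [div_lt_one hD']
        change z 0 * (1 + z 1) ^ 2 < z 1 * (z 1 - z 0) ^ 2 + z 0 * (1 + z 1) ^ 2
        have : 0 < z 1 * (z 1 - z 0) ^ 2 := mul_pos hm (pow_pos (sub_pos.2 h01) 2)
        linarith
      · have hq : 0 < (1 - z 1) / (1 + z 1) := div_pos (by linarith) (by linarith)
        have hq1 : (1 - z 1) / (1 + z 1) < 1 := by rw [div_lt_one (by linarith)]; linarith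
        exact ⟨pow_pos hq 2, pow_lt_one₀ hq.le hq1 two_ne_zero⟩
    · rintro ⟨hw0, hw1⟩
      -- the second coordinate: `m = (1 - √w₁)/(1 + √w₁)`
      set r : ℝ := Real.sqrt (w 1) with hr
      have hr0 : 0 < r := Real.sqrt_pos.2 hw1.1
      have hr1 : r < 1 := by rw [hr, Real.sqrt_lt' one_pos, one_pow]; exact hw1.2
      set m : ℝ := (1 - r) / (1 + r) with hm
      have hm0 : 0 < m := div_pos (by linarith) (by linarith)
      have hm1 : m < 1 := by rw [hm, div_lt_one (by linarith)]; linarith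
      have hmr : (1 - m) / (1 + m) = r := moebius_moebius hr0.le
      -- the first coordinate: intermediate value theorem for `t ↦ t(1+m)²/D̂(t,m)` on `[0, m]`
      set f : ℝ → ℝ := fun t => t * (1 + m) ^ 2 / (m * (m - t) ^ 2 + t * (1 + m) ^ 2) with hf
      have hfc : ContinuousOn f (Set.Icc 0 m) := by
        apply ContinuousOn.div (Continuous.continuousOn (by fun_prop)) (Continuous.continuousOn (by fun_prop))
        intro t ht
        exact (denomL_pos ht.1 hm0 hm1.le).ne'
      have hf0 : f 0 = 0 := by simp [hf]
      have hfm : f m = 1 := by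
        rw [hf]
        simp only [sub_self]
        rw [div_eq_one_iff_eq]
        · ring
        · have : 0 < m * (1 + m) ^ 2 := by positivity
          nlinarith
      have hmem : w 0 ∈ Set.Ioo (f 0) (f m) := by rw [hf0, hfm]; exact hw0
      obtain ⟨t, ⟨ht0, htm⟩, ht⟩ := intermediate_value_Ioo hm0.le hfc hmem
      refine ⟨![t, m], ⟨ht0, htm, hm1⟩, funext (Fin.forall_fin_two.2 ⟨ht, ?_⟩)⟩
      change ((1 - m) / (1 + m)) ^ 2 = w 1
      rw [hmr, hr, Real.sq_sqrt hw1.1.le]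
  · have hm : 0 < z 1 := lt_trans hz.1 hz.2.1
    rw [hdet z (hDpos z hz).ne' (by linarith), abs_neg, abs_of_pos]
    refine div_pos ?_ (mul_pos (by linarith) (pow_pos (hDpos z hz) 2))
    have h1 : 0 < 1 - z 1 := sub_pos.2 hz.2.2
    have h2 : 0 < z 1 ^ 2 - z 0 ^ 2 := by nlinarith [hz.1, hz.2.1]
    positivity

end TwinDupStep

end Summit.KontsevichZagierPeriods.FermatIsogeny.BetaProductSectorStubs

end
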